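import Mathlib
import Summits.NavierStokesRegularity.NavierStokesRegularity.Theorems.EulerZoomLiouvillePowerGaugeEulerLiouvilleHoopCrossModeLaw

/-!
# R48 plate t51-CM (2/2): the CROSS-MODE IDENTITY assembled (nsreg-p2 ROUND-48, `NsregP2.R48.CrossModeIdentity`, text VERBATIM
from `r48/Sketch48.lean` c9b3454dee49e2f5 l.99–106; seat ns-ezl-w2 g5, `--supports stmt-NavierStokesRegularity-19832 --as helper`)

`2∫₀^{T₀} ⟨c_r V_r − c_θ V_θ⟩_θ dt/t = −∫₀^{T₀} ⟨c_r ∂_zV_z + c_θ ω_z⟩_θ dt − ⟨c_r V_r − c_θ V_θ⟩_θ(s, T₀)` for `C¹` divergence-free `V`,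
`c₂ = 0`, `0 < T₀`: from the pointwise law `2m + t m′ = −t n` (`crossMode_pointwise_law`, part 1), `m(0) = 0`
(`crossMode_axis_zero`), `2m/t = −n − m′` on `(0, T₀]` and the fundamental theorem of calculus; the chart
(`eR_axisPt`, `eTheta_axisPt`, `curl_two_eq_rotFrame`) is valid for `t > 0`, and `t = 0` is invisible (`integral_congr_ae` on `Ι 0 T₀`).

HONEST FRAMING: class-free calculus (a ROUND-48 instrument statement); nothing about the crux E (19832 OPEN) or NS regularity.
[nsreg-p2 R48 §1.3; folklore]
-/

noncomputable section

open Set Filter Topology Metric Function MeasureTheory Real WithLp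
open scoped Interval InnerProductSpace RealInnerProductSpace

set_option linter.dupNamespace false

namespace Summit.NavierStokesRegularity.NavierStokesRegularity.Theorems.PowerGaugeEulerLiouville.HoopCore

open Literature.Analysis Literature.Analysis.FluidPDE

variable {V : EuclideanSpace ℝ (Fin 3) → EuclideanSpace ℝ (Fin 3)}

/-- **CROSS-MODE IDENTITY** (`NsregP2.R48.CrossModeIdentity`, text verbatim): for `C¹` divergence-free `V`, `c` with `c 2 = 0`,
`0 < T₀`: `2∫₀^{T₀} circleAvg (c_r V_r − c_θ V_θ)(s, t)/t dt = −∫₀^{T₀} circleAvg (c_r (DV e_z)₂ + c_θ (curl V)₂)(s, t) dt`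
`− circleAvg (c_r V_r − c_θ V_θ)(s, T₀)`. [nsreg-p2 R48 §1.3; folklore] -/
theorem crossModeIdentity :
    ∀ (V : EuclideanSpace ℝ (Fin 3) → EuclideanSpace ℝ (Fin 3)), ContDiff ℝ 1 V →
      (∀ y, VectorCalculus.divergence V y = 0) →
      ∀ (c : EuclideanSpace ℝ (Fin 3)), c 2 = 0 → ∀ (s T₀ : ℝ), 0 < T₀ →
        2 * (∫ t in (0 : ℝ)..T₀,
              circleAvg (fun y => ⟪c, eR y⟫ * radialVelocity V y - ⟪c, eTheta y⟫ * swirlVelocity V y) s t / t)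
          = - (∫ t in (0 : ℝ)..T₀,
                circleAvg (fun y => ⟪c, eR y⟫ * (fderiv ℝ V y eZ) 2 + ⟪c, eTheta y⟫ * (curl V y) 2) s t)
            - circleAvg (fun y => ⟪c, eR y⟫ * radialVelocity V y - ⟪c, eTheta y⟫ * swirlVelocity V y) s T₀ := by
  intro V hV hdiv c _ s T₀ hT₀
  have hVd : Differentiable ℝ V := hV.differentiable one_ne_zero
  have hVc : Continuous V := hV.continuous
  have hπ : (π : ℝ) ≠ 0 := Real.pi_ne_zero
  -- ### joint continuity on `ℝ × ℝ × ℝ` of the three integrands (m, m′, n)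
  have hcr3 : Continuous fun p : ℝ × ℝ × ℝ => ⟪c, rotZ p.2.2 (EuclideanSpace.single (0 : Fin 3) (1 : ℝ))⟫ :=
    continuous_const.inner (continuous_rotZ_single_zero.comp (continuous_snd.comp continuous_snd))
  have hcθ3 : Continuous fun p : ℝ × ℝ × ℝ => ⟪c, rotZ p.2.2 (EuclideanSpace.single (1 : Fin 3) (1 : ℝ))⟫ :=
    continuous_const.inner (continuous_rotZ_single_one.comp (continuous_snd.comp continuous_snd))
  have hM3 : Continuous fun p : ℝ × ℝ × ℝ => ⟪c, rotZ p.2.2 (EuclideanSpace.single (0 : Fin 3) (1 : ℝ))⟫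
      * ⟪V (axisPt p.1 p.2.1 p.2.2), rotZ p.2.2 (EuclideanSpace.single (0 : Fin 3) (1 : ℝ))⟫ - ⟪c,
      rotZ p.2.2 (EuclideanSpace.single (1 : Fin 3) (1 : ℝ))⟫ * ⟪V (axisPt p.1 p.2.1 p.2.2), rotZ p.2.2
      (EuclideanSpace.single (1 : Fin 3) (1 : ℝ))⟫ :=
    (hcr3.mul (continuous_sliceA hVc)).sub (hcθ3.mul (continuous_sliceB hVc))
  have hMd3 : Continuous fun p : ℝ × ℝ × ℝ => ⟪c, rotZ p.2.2 (EuclideanSpace.single (0 : Fin 3) (1 : ℝ))⟫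
      * ⟪fderiv ℝ V (axisPt p.1 p.2.1 p.2.2) (rotZ p.2.2 (EuclideanSpace.single (0 : Fin 3) (1 : ℝ))),
      rotZ p.2.2 (EuclideanSpace.single (0 : Fin 3) (1 : ℝ))⟫ - ⟪c, rotZ p.2.2
      (EuclideanSpace.single (1 : Fin 3) (1 : ℝ))⟫ * ⟪fderiv ℝ V (axisPt p.1 p.2.1 p.2.2) (rotZ p.2.2
      (EuclideanSpace.single (0 : Fin 3) (1 : ℝ))), rotZ p.2.2 (EuclideanSpace.single (1 : Fin 3) (1 : ℝ))⟫ :=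
    (hcr3.mul (continuous_sliceEntry hV continuous_rotZ_single_zero continuous_rotZ_single_zero)).sub
      (hcθ3.mul (continuous_sliceEntry hV continuous_rotZ_single_zero continuous_rotZ_single_one))
  have hN3 : Continuous fun p : ℝ × ℝ × ℝ => ⟪c, rotZ p.2.2 (EuclideanSpace.single (0 : Fin 3) (1 : ℝ))⟫
      * ⟪fderiv ℝ V (axisPt p.1 p.2.1 p.2.2) eZ, eZ⟫ + ⟪c, rotZ p.2.2
      (EuclideanSpace.single (1 : Fin 3) (1 : ℝ))⟫ * (⟪fderiv ℝ V (axisPt p.1 p.2.1 p.2.2) (rotZ p.2.2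
      (EuclideanSpace.single (0 : Fin 3) (1 : ℝ))), rotZ p.2.2
      (EuclideanSpace.single (1 : Fin 3) (1 : ℝ))⟫ - ⟪fderiv ℝ V (axisPt p.1 p.2.1 p.2.2) (rotZ p.2.2
      (EuclideanSpace.single (1 : Fin 3) (1 : ℝ))), rotZ p.2.2 (EuclideanSpace.single (0 : Fin 3) (1 : ℝ))⟫) :=
    (hcr3.mul (continuous_sliceEntry hV (u := fun _ => eZ) (w := fun _ => eZ) continuous_const continuous_const)).add
      (hcθ3.mul ((continuous_sliceEntry hV continuous_rotZ_single_zero continuous_rotZ_single_one).sub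
        (continuous_sliceEntry hV continuous_rotZ_single_one continuous_rotZ_single_zero)))
  -- ### `m` is differentiable in `t` with derivative `m′`; `m′`, `n` are continuous in `t`
  have hm : ∀ t, HasDerivAt (fun t => ∫ θ in (0 : ℝ)..2 * π, (⟪c, rotZ θ (EuclideanSpace.single (0 : Fin 3) (1 : ℝ))⟫
      * ⟪V (axisPt s t θ), rotZ θ (EuclideanSpace.single (0 : Fin 3) (1 : ℝ))⟫ - ⟪c, rotZ θ
      (EuclideanSpace.single (1 : Fin 3) (1 : ℝ))⟫ * ⟪V (axisPt s t θ), rotZ θ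
      (EuclideanSpace.single (1 : Fin 3) (1 : ℝ))⟫)) (∫ θ in (0 : ℝ)..2 * π, (⟪c, rotZ θ
      (EuclideanSpace.single (0 : Fin 3) (1 : ℝ))⟫ * ⟪fderiv ℝ V (axisPt s t θ) (rotZ θ
      (EuclideanSpace.single (0 : Fin 3) (1 : ℝ))), rotZ θ (EuclideanSpace.single (0 : Fin 3) (1 : ℝ))⟫ - ⟪c,
      rotZ θ (EuclideanSpace.single (1 : Fin 3) (1 : ℝ))⟫ * ⟪fderiv ℝ V (axisPt s t θ) (rotZ θ
      (EuclideanSpace.single (0 : Fin 3) (1 : ℝ))), rotZ θ (EuclideanSpace.single (1 : Fin 3) (1 : ℝ))⟫)) t :=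
    fun t => hasDerivAt_intervalIntegral_of_continuous
      (F := fun t θ => ⟪c, rotZ θ (EuclideanSpace.single (0 : Fin 3) (1 : ℝ))⟫ * ⟪V (axisPt s t θ),
          rotZ θ (EuclideanSpace.single (0 : Fin 3) (1 : ℝ))⟫ - ⟪c, rotZ θ (EuclideanSpace.single (1 : Fin 3) (1 : ℝ))⟫
          * ⟪V (axisPt s t θ), rotZ θ (EuclideanSpace.single (1 : Fin 3) (1 : ℝ))⟫)
      (F' := fun t θ => ⟪c, rotZ θ (EuclideanSpace.single (0 : Fin 3) (1 : ℝ))⟫ * ⟪fderiv ℝ V (axisPt s t θ)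
          (rotZ θ (EuclideanSpace.single (0 : Fin 3) (1 : ℝ))), rotZ θ (EuclideanSpace.single (0 : Fin 3) (1 : ℝ))⟫
          - ⟪c, rotZ θ (EuclideanSpace.single (1 : Fin 3) (1 : ℝ))⟫ * ⟪fderiv ℝ V (axisPt s t θ)
          (rotZ θ (EuclideanSpace.single (0 : Fin 3) (1 : ℝ))), rotZ θ (EuclideanSpace.single (1 : Fin 3) (1 : ℝ))⟫)
      (fun t θ => ((hasDerivAt_sliceA_radius hVd s t θ).const_mul _).sub ((hasDerivAt_sliceB_radius hVd s t θ).const_mul _))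
      (continuous_uncurry_slice hM3 s) (continuous_uncurry_slice hMd3 s) 0 (2 * π) t
  have hmdc : Continuous fun t => ∫ θ in (0 : ℝ)..2 * π, (⟪c, rotZ θ (EuclideanSpace.single (0 : Fin 3) (1 : ℝ))⟫
      * ⟪fderiv ℝ V (axisPt s t θ) (rotZ θ (EuclideanSpace.single (0 : Fin 3) (1 : ℝ))), rotZ θ
      (EuclideanSpace.single (0 : Fin 3) (1 : ℝ))⟫ - ⟪c, rotZ θ (EuclideanSpace.single (1 : Fin 3) (1 : ℝ))⟫
      * ⟪fderiv ℝ V (axisPt s t θ) (rotZ θ (EuclideanSpace.single (0 : Fin 3) (1 : ℝ))), rotZ θ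
      (EuclideanSpace.single (1 : Fin 3) (1 : ℝ))⟫) :=
    intervalIntegral.continuous_parametric_intervalIntegral_of_continuous' (continuous_uncurry_slice hMd3 s) _ _
  have hnc : Continuous fun t => ∫ θ in (0 : ℝ)..2 * π, (⟪c, rotZ θ (EuclideanSpace.single (0 : Fin 3) (1 : ℝ))⟫
      * ⟪fderiv ℝ V (axisPt s t θ) eZ, eZ⟫ + ⟪c, rotZ θ
      (EuclideanSpace.single (1 : Fin 3) (1 : ℝ))⟫ * (⟪fderiv ℝ V (axisPt s t θ) (rotZ θ
      (EuclideanSpace.single (0 : Fin 3) (1 : ℝ))), rotZ θ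
      (EuclideanSpace.single (1 : Fin 3) (1 : ℝ))⟫ - ⟪fderiv ℝ V (axisPt s t θ) (rotZ θ
      (EuclideanSpace.single (1 : Fin 3) (1 : ℝ))), rotZ θ (EuclideanSpace.single (0 : Fin 3) (1 : ℝ))⟫)) :=
    intervalIntegral.continuous_parametric_intervalIntegral_of_continuous' (continuous_uncurry_slice hN3 s) _ _
  -- ### chart forms of the two circle averages for `t > 0`
  have hGm : ∀ t, 0 < t → circleAvg (fun y => ⟪c, eR y⟫ * radialVelocity V y
      - ⟪c, eTheta y⟫ * swirlVelocity V y) s t = 1 / (2 * π) * ∫ θ in (0 : ℝ)..2 * π, (⟪c, rotZ θ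
      (EuclideanSpace.single (0 : Fin 3) (1 : ℝ))⟫ * ⟪V (axisPt s t θ), rotZ θ
      (EuclideanSpace.single (0 : Fin 3) (1 : ℝ))⟫ - ⟪c, rotZ θ (EuclideanSpace.single (1 : Fin 3) (1 : ℝ))⟫
      * ⟪V (axisPt s t θ), rotZ θ (EuclideanSpace.single (1 : Fin 3) (1 : ℝ))⟫) := by
    intro t ht
    simp only [circleAvg]
    congr 1
    refine intervalIntegral.integral_congr fun θ _ => ?_
    rw [eR_axisPt s ht θ, eTheta_axisPt s ht θ, ← inner_rotZ_single_zero_eq_radialVelocity V s ht θ,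
      ← inner_rotZ_single_one_eq_swirlVelocity V s ht θ]
  have heZ : ∀ x : EuclideanSpace ℝ (Fin 3), ⟪x, eZ⟫ = x 2 := fun x => by
    rw [eZ, EuclideanSpace.inner_single_right]; simp
  have hGn : ∀ t, 0 < t → circleAvg (fun y => ⟪c, eR y⟫ * (fderiv ℝ V y eZ) 2
      + ⟪c, eTheta y⟫ * (curl V y) 2) s t = 1 / (2 * π) * ∫ θ in (0 : ℝ)..2 * π, (⟪c, rotZ θ
      (EuclideanSpace.single (0 : Fin 3) (1 : ℝ))⟫ * ⟪fderiv ℝ V (axisPt s t θ) eZ, eZ⟫ + ⟪c, rotZ θ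
      (EuclideanSpace.single (1 : Fin 3) (1 : ℝ))⟫ * (⟪fderiv ℝ V (axisPt s t θ) (rotZ θ
      (EuclideanSpace.single (0 : Fin 3) (1 : ℝ))), rotZ θ
      (EuclideanSpace.single (1 : Fin 3) (1 : ℝ))⟫ - ⟪fderiv ℝ V (axisPt s t θ) (rotZ θ
      (EuclideanSpace.single (1 : Fin 3) (1 : ℝ))), rotZ θ (EuclideanSpace.single (0 : Fin 3) (1 : ℝ))⟫)) := by
    intro t ht
    simp only [circleAvg]
    congr 1
    refine intervalIntegral.integral_congr fun θ _ => ?_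
    rw [eR_axisPt s ht θ, eTheta_axisPt s ht θ, curl_apply_two, curl_two_eq_rotFrame, ← heZ]
  -- ### the `t`-integrals: integrands agree on `(0, T₀]` with smooth ones
  have hlaw := fun t => crossMode_pointwise_law hV hdiv c s t
  have hL : ∫ t in (0 : ℝ)..T₀, circleAvg (fun y => ⟪c, eR y⟫ * radialVelocity V y
      - ⟪c, eTheta y⟫ * swirlVelocity V y) s t / t =
      ∫ t in (0 : ℝ)..T₀, 1 / (2 * π) * ((-(∫ θ in (0 : ℝ)..2 * π, (⟪c, rotZ θ
          (EuclideanSpace.single (0 : Fin 3) (1 : ℝ))⟫ * ⟪fderiv ℝ V (axisPt s t θ) eZ, eZ⟫ + ⟪c,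
          rotZ θ (EuclideanSpace.single (1 : Fin 3) (1 : ℝ))⟫ * (⟪fderiv ℝ V (axisPt s t θ) (rotZ θ
          (EuclideanSpace.single (0 : Fin 3) (1 : ℝ))), rotZ θ
          (EuclideanSpace.single (1 : Fin 3) (1 : ℝ))⟫ - ⟪fderiv ℝ V (axisPt s t θ) (rotZ θ
          (EuclideanSpace.single (1 : Fin 3) (1 : ℝ))), rotZ θ
          (EuclideanSpace.single (0 : Fin 3) (1 : ℝ))⟫))) - ∫ θ in (0 : ℝ)..2 * π, (⟪c, rotZ θ
          (EuclideanSpace.single (0 : Fin 3) (1 : ℝ))⟫ * ⟪fderiv ℝ V (axisPt s t θ) (rotZ θ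
          (EuclideanSpace.single (0 : Fin 3) (1 : ℝ))), rotZ θ (EuclideanSpace.single (0 : Fin 3) (1 : ℝ))⟫ - ⟪c,
          rotZ θ (EuclideanSpace.single (1 : Fin 3) (1 : ℝ))⟫ * ⟪fderiv ℝ V (axisPt s t θ) (rotZ θ
          (EuclideanSpace.single (0 : Fin 3) (1 : ℝ))), rotZ θ (EuclideanSpace.single (1 : Fin 3) (1 : ℝ))⟫)) / 2) := by
    refine intervalIntegral.integral_congr_ae (Eventually.of_forall fun t ht => ?_)
    rw [uIoc_of_le hT₀.le] at ht
    have ht0 : t ≠ 0 := ht.1.ne'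
    rw [hGm t ht.1]
    have h := hlaw t
    field_simp
    linear_combination h
  have hR : ∫ t in (0 : ℝ)..T₀, circleAvg (fun y => ⟪c, eR y⟫ * (fderiv ℝ V y eZ) 2
      + ⟪c, eTheta y⟫ * (curl V y) 2) s t = ∫ t in (0 : ℝ)..T₀, 1 / (2 * π) * ∫ θ in (0 : ℝ)..2 * π, (⟪c,
      rotZ θ (EuclideanSpace.single (0 : Fin 3) (1 : ℝ))⟫ * ⟪fderiv ℝ V (axisPt s t θ) eZ, eZ⟫ + ⟪c,
      rotZ θ (EuclideanSpace.single (1 : Fin 3) (1 : ℝ))⟫ * (⟪fderiv ℝ V (axisPt s t θ) (rotZ θ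
      (EuclideanSpace.single (0 : Fin 3) (1 : ℝ))), rotZ θ
      (EuclideanSpace.single (1 : Fin 3) (1 : ℝ))⟫ - ⟪fderiv ℝ V (axisPt s t θ) (rotZ θ
      (EuclideanSpace.single (1 : Fin 3) (1 : ℝ))), rotZ θ (EuclideanSpace.single (0 : Fin 3) (1 : ℝ))⟫)) :=
    intervalIntegral.integral_congr_ae (Eventually.of_forall fun t ht => by
      rw [uIoc_of_le hT₀.le] at ht
      exact hGn t ht.1)
  have i_n : IntervalIntegrable (fun t => ∫ θ in (0 : ℝ)..2 * π, (⟪c, rotZ θ (EuclideanSpace.single (0 : Fin 3) (1 : ℝ))⟫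
      * ⟪fderiv ℝ V (axisPt s t θ) eZ, eZ⟫ + ⟪c, rotZ θ
      (EuclideanSpace.single (1 : Fin 3) (1 : ℝ))⟫ * (⟪fderiv ℝ V (axisPt s t θ) (rotZ θ
      (EuclideanSpace.single (0 : Fin 3) (1 : ℝ))), rotZ θ
      (EuclideanSpace.single (1 : Fin 3) (1 : ℝ))⟫ - ⟪fderiv ℝ V (axisPt s t θ) (rotZ θ
      (EuclideanSpace.single (1 : Fin 3) (1 : ℝ))), rotZ θ
      (EuclideanSpace.single (0 : Fin 3) (1 : ℝ))⟫))) volume 0 T₀ := hnc.intervalIntegrable _ _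
  have i_md : IntervalIntegrable (fun t => ∫ θ in (0 : ℝ)..2 * π, (⟪c, rotZ θ (EuclideanSpace.single (0 : Fin 3) (1 : ℝ))⟫
      * ⟪fderiv ℝ V (axisPt s t θ) (rotZ θ (EuclideanSpace.single (0 : Fin 3) (1 : ℝ))), rotZ θ
      (EuclideanSpace.single (0 : Fin 3) (1 : ℝ))⟫ - ⟪c, rotZ θ (EuclideanSpace.single (1 : Fin 3) (1 : ℝ))⟫
      * ⟪fderiv ℝ V (axisPt s t θ) (rotZ θ (EuclideanSpace.single (0 : Fin 3) (1 : ℝ))), rotZ θ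
      (EuclideanSpace.single (1 : Fin 3) (1 : ℝ))⟫)) volume 0 T₀ := hmdc.intervalIntegrable _ _
  have i_nn : IntervalIntegrable (fun t => -(∫ θ in (0 : ℝ)..2 * π, (⟪c, rotZ θ
      (EuclideanSpace.single (0 : Fin 3) (1 : ℝ))⟫ * ⟪fderiv ℝ V (axisPt s t θ) eZ, eZ⟫ + ⟪c, rotZ θ
      (EuclideanSpace.single (1 : Fin 3) (1 : ℝ))⟫ * (⟪fderiv ℝ V (axisPt s t θ) (rotZ θ
      (EuclideanSpace.single (0 : Fin 3) (1 : ℝ))), rotZ θ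
      (EuclideanSpace.single (1 : Fin 3) (1 : ℝ))⟫ - ⟪fderiv ℝ V (axisPt s t θ) (rotZ θ
      (EuclideanSpace.single (1 : Fin 3) (1 : ℝ))), rotZ θ
      (EuclideanSpace.single (0 : Fin 3) (1 : ℝ))⟫)))) volume 0 T₀ := hnc.neg.intervalIntegrable _ _
  have hsplit : ∫ t in (0 : ℝ)..T₀, 1 / (2 * π) * ((-(∫ θ in (0 : ℝ)..2 * π, (⟪c, rotZ θ
      (EuclideanSpace.single (0 : Fin 3) (1 : ℝ))⟫ * ⟪fderiv ℝ V (axisPt s t θ) eZ, eZ⟫ + ⟪c, rotZ θ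
      (EuclideanSpace.single (1 : Fin 3) (1 : ℝ))⟫ * (⟪fderiv ℝ V (axisPt s t θ) (rotZ θ
      (EuclideanSpace.single (0 : Fin 3) (1 : ℝ))), rotZ θ
      (EuclideanSpace.single (1 : Fin 3) (1 : ℝ))⟫ - ⟪fderiv ℝ V (axisPt s t θ) (rotZ θ
      (EuclideanSpace.single (1 : Fin 3) (1 : ℝ))), rotZ θ
      (EuclideanSpace.single (0 : Fin 3) (1 : ℝ))⟫))) - ∫ θ in (0 : ℝ)..2 * π, (⟪c, rotZ θ
      (EuclideanSpace.single (0 : Fin 3) (1 : ℝ))⟫ * ⟪fderiv ℝ V (axisPt s t θ) (rotZ θ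
      (EuclideanSpace.single (0 : Fin 3) (1 : ℝ))), rotZ θ (EuclideanSpace.single (0 : Fin 3) (1 : ℝ))⟫ - ⟪c,
      rotZ θ (EuclideanSpace.single (1 : Fin 3) (1 : ℝ))⟫ * ⟪fderiv ℝ V (axisPt s t θ) (rotZ θ
      (EuclideanSpace.single (0 : Fin 3) (1 : ℝ))), rotZ θ (EuclideanSpace.single (1 : Fin 3) (1 : ℝ))⟫)) / 2) =
      1 / (2 * π) * ((-(∫ t in (0 : ℝ)..T₀, ∫ θ in (0 : ℝ)..2 * π, (⟪c, rotZ θ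
          (EuclideanSpace.single (0 : Fin 3) (1 : ℝ))⟫ * ⟪fderiv ℝ V (axisPt s t θ) eZ, eZ⟫ + ⟪c,
          rotZ θ (EuclideanSpace.single (1 : Fin 3) (1 : ℝ))⟫ * (⟪fderiv ℝ V (axisPt s t θ) (rotZ θ
          (EuclideanSpace.single (0 : Fin 3) (1 : ℝ))), rotZ θ
          (EuclideanSpace.single (1 : Fin 3) (1 : ℝ))⟫ - ⟪fderiv ℝ V (axisPt s t θ) (rotZ θ
          (EuclideanSpace.single (1 : Fin 3) (1 : ℝ))), rotZ θ
          (EuclideanSpace.single (0 : Fin 3) (1 : ℝ))⟫))) - ∫ t in (0 : ℝ)..T₀, ∫ θ in (0 : ℝ)..2 * π, (⟪c,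
          rotZ θ (EuclideanSpace.single (0 : Fin 3) (1 : ℝ))⟫ * ⟪fderiv ℝ V (axisPt s t θ) (rotZ θ
          (EuclideanSpace.single (0 : Fin 3) (1 : ℝ))), rotZ θ (EuclideanSpace.single (0 : Fin 3) (1 : ℝ))⟫ - ⟪c,
          rotZ θ (EuclideanSpace.single (1 : Fin 3) (1 : ℝ))⟫ * ⟪fderiv ℝ V (axisPt s t θ) (rotZ θ
          (EuclideanSpace.single (0 : Fin 3) (1 : ℝ))), rotZ θ (EuclideanSpace.single (1 : Fin 3) (1 : ℝ))⟫)) / 2) := by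
    rw [intervalIntegral.integral_const_mul, intervalIntegral.integral_div, intervalIntegral.integral_sub i_nn i_md,
      intervalIntegral.integral_neg]
  have hFTC := intervalIntegral.integral_eq_sub_of_hasDerivAt (a := 0) (b := T₀) (fun t _ => hm t) i_md
  have hm0 := crossMode_axis_zero V c s
  rw [hL, hsplit, hR, intervalIntegral.integral_const_mul, hGm T₀ hT₀]
  linear_combination (-(1 / (2 * π))) * hFTC + (1 / (2 * π)) * hm0

end Summit.NavierStokesRegularity.NavierStokesRegularity.Theorems.PowerGaugeEulerLiouville.HoopCore

end
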